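import Mathlib
import Summits.ValiantsHypothesis.ValiantsHypothesis.Theses.ValuativeGCT
import Summits.ValiantsHypothesis.ValiantsHypothesis.Theorems.ValuativeGCTValuativeBound
import Summits.ValiantsHypothesis.ValiantsHypothesis.Theorems.ValuativeGCTNoValuativeFlipResidual
import Summits.ValiantsHypothesis.ValiantsHypothesis.Theorems.ValuativeGCTNoValuativeFlipOccurrence

/-!
# `NoValuativeFlip` (stmt-ValiantsHypothesis-12629): the sharp residual statement

Route `ValuativeGCT`, support item `NoValuativeFlip`. The first seat reduced the item to its
residual range (`noValuativeFlip_iff_residual`, unconditional since `ValuativeBound` landed):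
paddings `n ^ c₀ ≤ m` with `m + 1 < 2ⁿ` (below Grenet), Kadish–Landsberg shapes
(`δ (m - n) ≤ λ₁`, `ℓ(λ) ≤ n² + 1`) of length beyond the inheritance range
(`m < 1 + n (n + 1)^ℓ(λ)`). The occurrence shadow of the item being a theorem
(`ValuativeGCTNoValuativeFlipOccurrence`: Bürgisser–Ikenmeyer–Panova 2019 Thm. 1.4 as discharged
in the tree, plus `ValuativeBound_proof`), two more hypotheses come for free on that range:
the weight `λ*` OCCURS in `ℂ[Δ(det_m)]` (`0 < K_m(λ*)`, hence `0 < dim T_U(λ)`) and in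
`ℂ[Δ(X₀₀^(m-n) per_n)]` (`0 < mult_pp(λ*)`). `noValuativeFlip_iff_sharpResidual` records the
resulting normal form: what is open is a comparison of two POSITIVE multiplicities,
`mult_pp(λ*) ≤ dim T_U(λ)` given `0 < K_m(λ*) ≤ dim T_U(λ)`, on Kadish–Landsberg shapes of
growing length at paddings `n ^ c₀ ≤ m < 2ⁿ - 1` (the multiplicity no-go question,
Bläser–Ikenmeyer 2025 §12.4; cf. `GCTMult.GctNoMultBarrier`, stmt-ValiantsHypothesis-0890, which
implies the item). `valuativeFlip_witness_occurs` is the contrapositive packaging for the crux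
`ValuativeFlip` (stmt-12624): a flip witness at `m ≥ n ^ 25` has `0 < K_m(λ*)` and
`0 < dim T_U(λ)`.

Sources: P. Bürgisser, C. Ikenmeyer, G. Panova, J. AMS 32 (2019) Thm. 1.4; H. Kadish,
J. M. Landsberg, Adv. Math. 259 (2014) Thm. 1.2; M. Bläser, C. Ikenmeyer, Theory of Computing
Graduate Surveys 10 (2025) §12.4.
-/

-- `Summit.ValiantsHypothesis.ValiantsHypothesis.…` repeats a component by the D-0017 layout
-- (single-conjunct summit), which the `dupNamespace` linter flags; the name is mandated.
set_option linter.dupNamespace false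

namespace Summit.ValiantsHypothesis.ValiantsHypothesis.Theorems.NoValuativeFlip

open Literature.NumberTheory.DiophantineGeometry Literature.Computability.AlgebraicComplexity
open Summit.ValiantsHypothesis.ValiantsHypothesis.Theses.ValuativeGCT
open Summit.ValiantsHypothesis.ValiantsHypothesis.Theorems.ValuativeBound

/-- **A valuative-flip witness at polynomial padding occurs on both sides.** For `0 < n`,
`n ^ 25 ≤ m`, a centre `(U, r)`, a degree `δ` and `λ ⊢ mδ` (at most `m²` parts) with
`dim T_U(λ) < mult_λ* ℂ[Δ(X₀₀^(m-n) per_n)]`: the weight `λ*` occurs in `ℂ[Δ(det_m)]`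
(`0 < K_m(λ*)`, occurrence transfer `orbitMultiplicity_det_pos_of_paddedPer_pos`) and the
truncation is nonzero (`0 < dim T_U(λ)`, by `ValuativeBound_proof`). Complements
`valuativeFlip_witness_constraints` (below Grenet, Kadish–Landsberg shape, length beyond the
inheritance range). [Bürgisser–Ikenmeyer–Panova 2019, Thm. 1.4; this route] -/
theorem valuativeFlip_witness_occurs {n : ℕ} (m : ℕ) [NeZero m] (hn : 0 < n) (hnm : n ^ 25 ≤ m)
    (U : Submodule ℂ (Literature.NumberTheory.DiophantineGeometry.MatIdx m → ℂ)) (r : ℕ)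
    (hU : ∀ u ∈ U, (Matrix.of fun a b : Fin m => u (toLex (a, b))).rank ≤ r)
    (δ : ℕ) (lam : Nat.Partition (m * δ)) (hcard : lam.parts.card ≤ m * m)
    (hflip : let χ : Literature.NumberTheory.DiophantineGeometry.Weight (Literature.NumberTheory.DiophantineGeometry.MatIdx m) := (Literature.NumberTheory.DiophantineGeometry.Weight.dualOfPartition (m * m) lam).toMatIdx; let T : Submodule ℂ (MvPolynomial (Literature.NumberTheory.DiophantineGeometry.MatIdx m × Literature.NumberTheory.DiophantineGeometry.MatIdx m) ℂ) := MvPolynomial.homogeneousSubmodule (Literature.NumberTheory.DiophantineGeometry.MatIdx m × Literature.NumberTheory.DiophantineGeometry.MatIdx m) ℂ (m * δ) ⊓ ((MvPolynomial.vanishingIdeal ℂ {p : Literature.NumberTheory.DiophantineGeometry.MatIdx m × Literature.NumberTheory.DiophantineGeometry.MatIdx m → ℂ | ∀ j : Literature.NumberTheory.DiophantineGeometry.MatIdx m, (fun i => p (j, i)) ∈ U}) ^ (δ * (m - r))).restrictScalars ℂ ⊓ (⨅ (M : Matrix (Literature.NumberTheory.DiophantineGeometry.MatIdx m) (Literature.NumberTheory.DiophantineGeometry.MatIdx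 m) ℂ) (_ : Literature.Computability.AlgebraicComplexity.linSubst (Literature.NumberTheory.DiophantineGeometry.MatIdx m) ℂ M (Literature.NumberTheory.DiophantineGeometry.detFormLex ℂ m) = Literature.NumberTheory.DiophantineGeometry.detFormLex ℂ m), LinearMap.ker ((MvPolynomial.aeval (R := ℂ) fun p : Literature.NumberTheory.DiophantineGeometry.MatIdx m × Literature.NumberTheory.DiophantineGeometry.MatIdx m => ∑ l : Literature.NumberTheory.DiophantineGeometry.MatIdx m, M l p.2 • MvPolynomial.X (p.1, l)).toLinearMap - LinearMap.id (R := ℂ) (M := MvPolynomial (Literature.NumberTheory.DiophantineGeometry.MatIdx m × Literature.NumberTheory.DiophantineGeometry.MatIdx m) ℂ))) ⊓ (⨅ (g : Matrix.GeneralLinearGroup (Literature.NumberTheory.DiophantineGeometry.MatIdx m) ℂ) (_ : Literature.NumberTheory.DiophantineGeometry.IsUpperTriangular g), LinearMap.ker ((MvPolynomial.aeval (R := ℂ) fun p : Literature.NumberTheory.DiophantineGeometry.MatIdx m × Literature.NumberTheory.DiophantineGeometry.MatIdx m => ∑ l : Literature.NumberTheory.DiophantineGeometry.MatIdx m, ((g⁻¹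 : Matrix.GeneralLinearGroup (Literature.NumberTheory.DiophantineGeometry.MatIdx m) ℂ) : Matrix (Literature.NumberTheory.DiophantineGeometry.MatIdx m) (Literature.NumberTheory.DiophantineGeometry.MatIdx m) ℂ) p.1 l • MvPolynomial.X (l, p.2)).toLinearMap - Literature.NumberTheory.DiophantineGeometry.weightChar χ g • LinearMap.id (R := ℂ) (M := MvPolynomial (Literature.NumberTheory.DiophantineGeometry.MatIdx m × Literature.NumberTheory.DiophantineGeometry.MatIdx m) ℂ))); Module.finrank ℂ ↥T < Literature.NumberTheory.DiophantineGeometry.orbitMultiplicity ℂ (Literature.NumberTheory.DiophantineGeometry.paddedPerFormLex ℂ n m) m χ) :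
    let χ : Literature.NumberTheory.DiophantineGeometry.Weight (Literature.NumberTheory.DiophantineGeometry.MatIdx m) := (Literature.NumberTheory.DiophantineGeometry.Weight.dualOfPartition (m * m) lam).toMatIdx; let T : Submodule ℂ (MvPolynomial (Literature.NumberTheory.DiophantineGeometry.MatIdx m × Literature.NumberTheory.DiophantineGeometry.MatIdx m) ℂ) := MvPolynomial.homogeneousSubmodule (Literature.NumberTheory.DiophantineGeometry.MatIdx m × Literature.NumberTheory.DiophantineGeometry.MatIdx m) ℂ (m * δ) ⊓ ((MvPolynomial.vanishingIdeal ℂ {p : Literature.NumberTheory.DiophantineGeometry.MatIdx m × Literature.NumberTheory.DiophantineGeometry.MatIdx m → ℂ | ∀ j : Literature.NumberTheory.DiophantineGeometry.MatIdx m, (fun i => p (j, i)) ∈ U}) ^ (δ * (m - r))).restrictScalars ℂ ⊓ (⨅ (M : Matrix (Literature.NumberTheory.DiophantineGeometry.MatIdx m) (Literature.NumberTheory.DiophantineGeometry.MatIdx m) ℂ) (_ : Literature.Computability.AlgebraicComplexity.linSubst (Literature.NumberTheory.DiophantineGeometry.MatIdx m) ℂ M (Literature.NumberTheory.DiophantineGeometry.detFormLex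 ℂ m) = Literature.NumberTheory.DiophantineGeometry.detFormLex ℂ m), LinearMap.ker ((MvPolynomial.aeval (R := ℂ) fun p : Literature.NumberTheory.DiophantineGeometry.MatIdx m × Literature.NumberTheory.DiophantineGeometry.MatIdx m => ∑ l : Literature.NumberTheory.DiophantineGeometry.MatIdx m, M l p.2 • MvPolynomial.X (p.1, l)).toLinearMap - LinearMap.id (R := ℂ) (M := MvPolynomial (Literature.NumberTheory.DiophantineGeometry.MatIdx m × Literature.NumberTheory.DiophantineGeometry.MatIdx m) ℂ))) ⊓ (⨅ (g : Matrix.GeneralLinearGroup (Literature.NumberTheory.DiophantineGeometry.MatIdx m) ℂ) (_ : Literature.NumberTheory.DiophantineGeometry.IsUpperTriangular g), LinearMap.ker ((MvPolynomial.aeval (R := ℂ) fun p : Literature.NumberTheory.DiophantineGeometry.MatIdx m × Literature.NumberTheory.DiophantineGeometry.MatIdx m => ∑ l : Literature.NumberTheory.DiophantineGeometry.MatIdx m, ((g⁻¹ : Matrix.GeneralLinearGroup (Literature.NumberTheory.DiophantineGeometry.MatIdx m) ℂ) : Matrix (Literature.NumberTheory.DiophantineGeometry.MatIdx m) (Literature.NumberTheory.DiophantineGeometry.MatIdx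 m) ℂ) p.1 l • MvPolynomial.X (l, p.2)).toLinearMap - Literature.NumberTheory.DiophantineGeometry.weightChar χ g • LinearMap.id (R := ℂ) (M := MvPolynomial (Literature.NumberTheory.DiophantineGeometry.MatIdx m × Literature.NumberTheory.DiophantineGeometry.MatIdx m) ℂ))); 0 < Literature.NumberTheory.DiophantineGeometry.orbitMultiplicity ℂ (Literature.NumberTheory.DiophantineGeometry.detFormLex ℂ m) m χ ∧ 0 < Module.finrank ℂ ↥T := by
  intro χ T
  have hpos : 0 < Literature.NumberTheory.DiophantineGeometry.orbitMultiplicity ℂ (Literature.NumberTheory.DiophantineGeometry.paddedPerFormLex ℂ n m) m χ :=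
    lt_of_le_of_lt (Nat.zero_le _) hflip
  have hK := orbitMultiplicity_det_pos_of_paddedPer_pos hn hnm χ hpos
  exact ⟨hK, lt_of_lt_of_le hK (ValuativeBound_proof m U r hU δ lam hcard)⟩

/-- **The sharp residual form of `NoValuativeFlip`.** The item holds iff its inequality
`mult_pp(λ*) ≤ dim T_U(λ)` holds on the residual range of `noValuativeFlip_iff_residual` (fed with `ValuativeBound_proof`)
(`n ^ c₀ ≤ m`, `m + 1 < 2ⁿ`; `δ (m - n) ≤ λ₁`, `ℓ(λ) ≤ n² + 1`; `m < 1 + n (n + 1)^ℓ(λ)`) AT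
THE WEIGHTS OCCURRING ON BOTH SIDES (`0 < K_m(λ*)` and `0 < mult_pp(λ*)`). `→` forgets the
hypotheses; `←` runs the residual reduction with `(max c₀ 25, max n₀ 1)`: at a weight with
`mult_pp(λ*) = 0` there is nothing to show, and otherwise `0 < K_m(λ*)` by the occurrence
transfer (`orbitMultiplicity_det_pos_of_paddedPer_pos`, `n ^ 25 ≤ n ^ max c₀ 25 ≤ m`).
[Bürgisser–Ikenmeyer–Panova 2019, Thm. 1.4; Kadish–Landsberg 2014; this route] -/
theorem noValuativeFlip_iff_sharpResidual :
    NoValuativeFlip ↔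
    ∃ c₀ n₀ : ℕ, ∀ n ≥ n₀, ∀ (m : ℕ) [NeZero m], n ^ c₀ ≤ m → m + 1 < 2 ^ n → ∀ (U : Submodule ℂ (Literature.NumberTheory.DiophantineGeometry.MatIdx m → ℂ)) (r : ℕ), (∀ u ∈ U, (Matrix.of fun a b : Fin m => u (toLex (a, b))).rank ≤ r) → ∀ (δ : ℕ) (lam : Nat.Partition (m * δ)), lam.parts.card ≤ m * m → δ * (m - n) ≤ lam.parts.sup → lam.parts.card ≤ n ^ 2 + 1 → m < 1 + n * (n + 1) ^ lam.parts.card → let χ : Literature.NumberTheory.DiophantineGeometry.Weight (Literature.NumberTheory.DiophantineGeometry.MatIdx m) := (Literature.NumberTheory.DiophantineGeometry.Weight.dualOfPartition (m * m) lam).toMatIdx; let T : Submodule ℂ (MvPolynomial (Literature.NumberTheory.DiophantineGeometry.MatIdx m × Literature.NumberTheory.DiophantineGeometry.MatIdx m) ℂ) := MvPolynomial.homogeneousSubmodule (Literature.NumberTheory.DiophantineGeometry.MatIdx m × Literature.NumberTheory.DiophantineGeometry.MatIdx m) ℂ (m * δ) ⊓ ((MvPolynomial.vanishingIdeal ℂ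 {p : Literature.NumberTheory.DiophantineGeometry.MatIdx m × Literature.NumberTheory.DiophantineGeometry.MatIdx m → ℂ | ∀ j : Literature.NumberTheory.DiophantineGeometry.MatIdx m, (fun i => p (j, i)) ∈ U}) ^ (δ * (m - r))).restrictScalars ℂ ⊓ (⨅ (M : Matrix (Literature.NumberTheory.DiophantineGeometry.MatIdx m) (Literature.NumberTheory.DiophantineGeometry.MatIdx m) ℂ) (_ : Literature.Computability.AlgebraicComplexity.linSubst (Literature.NumberTheory.DiophantineGeometry.MatIdx m) ℂ M (Literature.NumberTheory.DiophantineGeometry.detFormLex ℂ m) = Literature.NumberTheory.DiophantineGeometry.detFormLex ℂ m), LinearMap.ker ((MvPolynomial.aeval (R := ℂ) fun p : Literature.NumberTheory.DiophantineGeometry.MatIdx m × Literature.NumberTheory.DiophantineGeometry.MatIdx m => ∑ l : Literature.NumberTheory.DiophantineGeometry.MatIdx m, M l p.2 • MvPolynomial.X (p.1, l)).toLinearMap - LinearMap.id (R := ℂ) (M := MvPolynomial (Literature.NumberTheory.DiophantineGeometry.MatIdx m × Literature.NumberTheory.DiophantineGeometry.MatIdx m) ℂ))) ⊓ (⨅ (g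 : Matrix.GeneralLinearGroup (Literature.NumberTheory.DiophantineGeometry.MatIdx m) ℂ) (_ : Literature.NumberTheory.DiophantineGeometry.IsUpperTriangular g), LinearMap.ker ((MvPolynomial.aeval (R := ℂ) fun p : Literature.NumberTheory.DiophantineGeometry.MatIdx m × Literature.NumberTheory.DiophantineGeometry.MatIdx m => ∑ l : Literature.NumberTheory.DiophantineGeometry.MatIdx m, ((g⁻¹ : Matrix.GeneralLinearGroup (Literature.NumberTheory.DiophantineGeometry.MatIdx m) ℂ) : Matrix (Literature.NumberTheory.DiophantineGeometry.MatIdx m) (Literature.NumberTheory.DiophantineGeometry.MatIdx m) ℂ) p.1 l • MvPolynomial.X (l, p.2)).toLinearMap - Literature.NumberTheory.DiophantineGeometry.weightChar χ g • LinearMap.id (R := ℂ) (M := MvPolynomial (Literature.NumberTheory.DiophantineGeometry.MatIdx m × Literature.NumberTheory.DiophantineGeometry.MatIdx m) ℂ))); 0 < Literature.NumberTheory.DiophantineGeometry.orbitMultiplicity ℂ (Literature.NumberTheory.DiophantineGeometry.detFormLex ℂ m) m χ → 0 < Literature.NumberTheory.DiophantineGeometry.orbitMultiplicity ℂ (Literature.NumberTheory.DiophantineGeometry.paddedPerFormLex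 ℂ n m) m χ → Literature.NumberTheory.DiophantineGeometry.orbitMultiplicity ℂ (Literature.NumberTheory.DiophantineGeometry.paddedPerFormLex ℂ n m) m χ ≤ Module.finrank ℂ ↥T := by
  constructor
  · rintro ⟨c₀, n₀, h⟩
    refine ⟨c₀, n₀, fun n hn m _ hm _ U r hU δ lam hcard _ _ _ => ?_⟩
    intro χ T _ _
    exact h n hn m hm U r hU δ lam hcard
  · rintro ⟨c₀, n₀, h⟩
    rw [noValuativeFlip_iff_residual ValuativeBound_proof]
    refine ⟨max c₀ 25, max n₀ 1, fun n hn m _ hm hG U r hU δ lam hcard hKL₁ hKL₂ hI => ?_⟩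
    intro χ T
    have hn₀ : n₀ ≤ n := le_trans (le_max_left _ _) hn
    have hn1 : 1 ≤ n := le_trans (le_max_right _ _) hn
    have hm₀ : n ^ c₀ ≤ m := le_trans (Nat.pow_le_pow_right hn1 (le_max_left _ _)) hm
    have hm25 : n ^ 25 ≤ m := le_trans (Nat.pow_le_pow_right hn1 (le_max_right _ _)) hm
    rcases Nat.eq_zero_or_pos (Literature.NumberTheory.DiophantineGeometry.orbitMultiplicity ℂ (Literature.NumberTheory.DiophantineGeometry.paddedPerFormLex ℂ n m) m χ) with h0 | hpos
    · rw [h0]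
      exact Nat.zero_le _
    · exact h n hn₀ m hm₀ hG U r hU δ lam hcard hKL₁ hKL₂ hI
        (orbitMultiplicity_det_pos_of_paddedPer_pos hn1 hm25 χ hpos) hpos

end Summit.ValiantsHypothesis.ValiantsHypothesis.Theorems.NoValuativeFlip
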